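import Literature.AlgebraicGeometry.RelativeSpec.SubringSpecLift
import Mathlib.RingTheory.IntegralClosure.IntegrallyClosed
import Mathlib.AlgebraicGeometry.Morphisms.Finite
import Mathlib.AlgebraicGeometry.Noetherian
import Mathlib.AlgebraicGeometry.ZariskisMainTheorem
import Mathlib.RingTheory.Adjoin.Tower
import HarnessLib

/-!
# The relative spectrum of a quasi-coherent subalgebra of `f_* 𝒪_X`, IV: sections over the
# charts, normality of the local rings, and finiteness lemmas for sandwiched morphisms

Complements to `Literature.AlgebraicGeometry.RelativeSpec.SubringSpec` / `SubringSpecLift`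
(the relative spectrum `D.spec = Spec_Y(D.ring)` of a subring datum `D` for a qcqs `f : X ⟶ Y`,
with `toSpec : X → Spec_Y(D.ring)` and `fromSpec : Spec_Y(D.ring) → Y`):

* `SubringDatum.toSpec_appLE_objIso_inv`, `range_toSpec_appLE` — over the chart
  `fromSpec⁻¹U`, `U ⊆ Y` affine, the pull-back `toSpec^* : Γ(Spec_Y, fromSpec⁻¹U) → Γ(X, f⁻¹U)`
  is the inclusion `D.ring U ⊆ Γ(X, f⁻¹U)` (so its range is exactly `D.ring U`);
* `SubringDatum.isIntegrallyClosed_stalk` — if the `D.ring U`, `U` affine, are integrally closed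
  domains then `Spec_Y(D.ring)` is normal (its local rings are localisations of the `D.ring U`;
  Stacks 030B / 033I);
* `surjective_of_universallyClosed_of_isDominant` — a closed dominant morphism is surjective;
* `locallyOfFiniteType_of_isFinite_of_injective` — **Artin–Tate for a sandwich**: if
  `u : X₁ → Z` is finite with injective `u^*` on affine opens, `u ≫ v` is locally of finite type
  and the target of `v` is locally noetherian, then `v` is locally of finite type (Mathlib
  `fg_of_fg_of_fg`; Atiyah–Macdonald, Prop. 7.8);
* `finite_fiber_of_isFinite_morphismRestrict`, `exists_isFinite_morphismRestrict_of_comp` — the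
  fibre over a point of an open over which a morphism is finite is finite, and if `u ≫ v` is
  finite over a neighbourhood of `x` with `u` surjective and `v` proper then `v` is finite over a
  neighbourhood of `x` (Zariski's Main Theorem in Mathlib's form
  `exists_isFinite_morphismRestrict_of_finite_preimage_singleton`, Stacks 02UP).

These are the chart-level inputs for sandwiched models `X₁ —u→ Spec_Y(D.ring) —v→ X` (e.g. the
infinitesimal quotients of de Jong's Galois alterations, de Jong 1997, 5.3).

## References

* [StacksProject, Tag 01LQ] (relative spectrum), [Tag 030B, Tag 033I] (normality is local),
  [Tag 02UP] (finite over a neighbourhood of a finite fibre).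
* M. F. Atiyah, I. G. Macdonald, *Introduction to Commutative Algebra* (1969), Prop. 7.8
  (Artin–Tate).
-/

noncomputable section

universe u

open CategoryTheory Limits AlgebraicGeometry

namespace Literature.AlgebraicGeometry.RelativeSpec

namespace SubringDatum

variable {X Y : Scheme.{u}} {f : X ⟶ Y} (D : SubringDatum f) [QuasiCompact f] [QuasiSeparated f]

/-! ### `toSpec` on sections over the charts -/

/-- `toSpec⁻¹(fromSpec⁻¹U) = f⁻¹U`. [folklore] -/
theorem toSpec_preimage_fromSpec_preimage (U : Y.Opens) :
    D.toSpec ⁻¹ᵁ (D.fromSpec ⁻¹ᵁ U) = f ⁻¹ᵁ U := by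
  rw [← Scheme.Hom.comp_preimage, toSpec_fromSpec]

/-- `f⁻¹U ≤ toSpec⁻¹(fromSpec⁻¹U)`. [folklore] -/
theorem preimage_le_toSpec_preimage (U : Y.Opens) :
    f ⁻¹ᵁ U ≤ D.toSpec ⁻¹ᵁ (D.fromSpec ⁻¹ᵁ U) :=
  (D.toSpec_preimage_fromSpec_preimage U).ge

/-- **`toSpec^*` over a chart is the inclusion `D.ring U ⊆ Γ(X, f⁻¹U)`**: for `U` affine and
`s ∈ D.ring U`, the pull-back along `toSpec` of the section `objIso⁻¹ s` of `Spec_Y(D.ring)`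
over `fromSpec⁻¹U` is `s` itself. [folklore] -/
theorem toSpec_appLE_objIso_inv (U : Y.affineOpens) (s : D.ring U.1) :
    D.toSpec.appLE (D.fromSpec ⁻¹ᵁ U.1) (f ⁻¹ᵁ U.1) (D.preimage_le_toSpec_preimage U.1)
      ((D.objIso U.2).inv s) = (s : Γ(X, f ⁻¹ᵁ U.1)) := by
  have h := D.objIso_hom_comp f D.inclusion D.diagramMap_inclusion U
  have h' := congrArg (fun φ ↦ φ ((D.objIso U.2).inv s)) h
  simp only [CommRingCat.comp_apply] at h'
  change (D.inclusion.app (.op U.1)) (((D.objIso U.2).inv ≫ (D.objIso U.2).hom) s) = _ at h'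
  rw [Iso.inv_hom_id] at h'
  exact h'.symm

/-- **The sections of `Spec_Y(D.ring)` over the chart `fromSpec⁻¹U` are exactly `D.ring U`**
(through `toSpec^*`), `U ⊆ Y` affine. [folklore] -/
theorem range_toSpec_appLE (U : Y.affineOpens) :
    Set.range (D.toSpec.appLE (D.fromSpec ⁻¹ᵁ U.1) (f ⁻¹ᵁ U.1) (D.preimage_le_toSpec_preimage U.1)) =
      (D.ring U.1 : Set Γ(X, f ⁻¹ᵁ U.1)) := by
  ext x
  constructor
  · rintro ⟨z, rfl⟩
    have hz : z = (D.objIso U.2).inv ((D.objIso U.2).hom z) := by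
      rw [← CommRingCat.comp_apply, Iso.hom_inv_id]; rfl
    rw [hz, toSpec_appLE_objIso_inv]
    exact ((D.objIso U.2).hom z).2
  · intro hx
    exact ⟨(D.objIso U.2).inv ⟨x, hx⟩, D.toSpec_appLE_objIso_inv U ⟨x, hx⟩⟩

/-- A section of `Spec_Y(D.ring)` over the chart `fromSpec⁻¹U` with given pull-back
`s ∈ D.ring U`. [folklore] -/
theorem exists_toSpec_appLE_eq (U : Y.affineOpens) {s : Γ(X, f ⁻¹ᵁ U.1)} (hs : s ∈ D.ring U.1) :
    ∃ z : Γ(D.spec, D.fromSpec ⁻¹ᵁ U.1),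
      D.toSpec.appLE (D.fromSpec ⁻¹ᵁ U.1) (f ⁻¹ᵁ U.1) (D.preimage_le_toSpec_preimage U.1) z = s :=
  ⟨(D.objIso U.2).inv ⟨s, hs⟩, D.toSpec_appLE_objIso_inv U ⟨s, hs⟩⟩

/-- `toSpec^*` is injective on sections over the charts. [folklore] -/
theorem toSpec_appLE_injective (U : Y.affineOpens) :
    Function.Injective
      (D.toSpec.appLE (D.fromSpec ⁻¹ᵁ U.1) (f ⁻¹ᵁ U.1) (D.preimage_le_toSpec_preimage U.1)) := by
  intro z₁ z₂ h
  have e₁ : z₁ = (D.objIso U.2).inv ((D.objIso U.2).hom z₁) := by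
    rw [← CommRingCat.comp_apply, Iso.hom_inv_id]; rfl
  have e₂ : z₂ = (D.objIso U.2).inv ((D.objIso U.2).hom z₂) := by
    rw [← CommRingCat.comp_apply, Iso.hom_inv_id]; rfl
  rw [e₁, e₂, toSpec_appLE_objIso_inv, toSpec_appLE_objIso_inv] at h
  rw [e₁, e₂, Subtype.ext h]

/-! ### Normality of the local rings -/

/-- Every point of `Spec_Y(D.ring)` lies in a chart `Spec (D.ring U)`, `U ⊆ Y` affine, and then
`D.ring U` is nontrivial. [folklore] -/
theorem exists_openCover_f_eq (z : D.spec) :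
    ∃ (U : Y.affineOpens) (q : D.openCover.X U), D.openCover.f U q = z ∧ Nontrivial (D.ring U.1) := by
  obtain ⟨U, q, rfl⟩ := D.openCover.exists_eq z
  refine ⟨U, q, rfl, ?_⟩
  change Spec (CommRingCat.of (D.ring U.1)) at q
  by_contra h
  rw [not_nontrivial_iff_subsingleton] at h
  exact (inferInstance : IsEmpty (PrimeSpectrum (D.ring U.1))).false q

/-- **`Spec_Y(D.ring)` is normal when the `D.ring U` are integrally closed domains** (`U ⊆ Y`
affine with `D.ring U` nontrivial): its local rings are localisations at primes of these rings
(Stacks 030B: a localisation of an integrally closed domain is integrally closed; Stacks 033I).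
[folklore] -/
theorem isIntegrallyClosed_stalk
    (h : ∀ U : Y.affineOpens, Nontrivial (D.ring U.1) →
      IsDomain (D.ring U.1) ∧ IsIntegrallyClosed (D.ring U.1))
    (z : D.spec) : IsIntegrallyClosed (D.spec.presheaf.stalk z) := by
  obtain ⟨U, q, rfl, hnt⟩ := D.exists_openCover_f_eq z
  obtain ⟨h1, h2⟩ := h U hnt
  let R : CommRingCat.{u} := .of (D.ring U.1)
  haveI : IsDomain R := h1
  haveI : IsIntegrallyClosed R := h2
  change Spec R at q
  have hR : IsIntegrallyClosed ((Spec R).presheaf.stalk q) := by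
    letI : Algebra R ((Spec R).presheaf.stalk q) :=
      inferInstanceAs (Algebra R ((Spec.structureSheaf R).presheaf.stalk q))
    haveI : IsLocalization.AtPrime ((Spec R).presheaf.stalk q) q.asIdeal :=
      StructureSheaf.IsLocalization.to_stalk R q
    exact isIntegrallyClosed_of_isLocalization _ q.asIdeal.primeCompl
      (Ideal.primeCompl_le_nonZeroDivisors _)
  exact @IsIntegrallyClosed.of_equiv _ _ _ _
    (asIso ((D.openCover.f U).stalkMap q)).commRingCatIsoToRingEquiv.symm hR

end SubringDatum

/-! ### Closed dominant morphisms; compactness -/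

/-- **A universally closed dominant morphism is surjective** (its image is closed and dense).
[folklore] -/
theorem surjective_of_universallyClosed_of_isDominant {X Y : Scheme.{u}} (f : X ⟶ Y)
    [UniversallyClosed f] [IsDominant f] : Function.Surjective f := by
  rw [← Set.range_eq_univ]
  have hc : IsClosed (Set.range f) := f.isClosedMap.isClosed_range
  rw [← hc.closure_eq]
  exact f.denseRange.closure_range

/-- The image of a quasi-compact scheme under a surjective morphism is quasi-compact.
[folklore] -/
theorem compactSpace_of_surjective {X Y : Scheme.{u}} (f : X ⟶ Y) [CompactSpace X]
    (hf : Function.Surjective f) : CompactSpace Y := by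
  rw [← isCompact_univ_iff, ← hf.range_eq, ← Set.image_univ]
  exact isCompact_univ.image f.continuous

/-! ### Artin–Tate for a sandwich `X₁ —u→ Z —v→ X` -/

/-- **Artin–Tate for sandwiched morphisms.** Let `u : X₁ → Z` be finite with `u^*` injective
on the sections over affine opens, `u ≫ v : X₁ → X` locally of finite type, and `X` locally
noetherian. Then `v : Z → X` is locally of finite type: over affines `V ⊆ v⁻¹W`, the ring
`Γ(Z, V) ⊆ Γ(X₁, u⁻¹V)` sits under a finite extension which is of finite type over the
noetherian `Γ(X, W)` (Mathlib `fg_of_fg_of_fg`). [cite: AtiyahMacdonald1969, Prop. 7.8] -/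
theorem locallyOfFiniteType_of_isFinite_of_injective {X₁ Z X : Scheme.{u}} (u : X₁ ⟶ Z)
    (v : Z ⟶ X) [IsFinite u] [LocallyOfFiniteType (u ≫ v)] [IsLocallyNoetherian X]
    (hu : ∀ V : Z.affineOpens, Function.Injective (u.app V.1)) : LocallyOfFiniteType v := by
  refine ⟨fun {W} hW {V} hV e ↦ ?_⟩
  classical
  -- the three rings `A = Γ(X, W)`, `B = Γ(Z, V)`, `C = Γ(X₁, u⁻¹V)`
  have hV' : IsAffineOpen (u ⁻¹ᵁ V) := hV.preimage u
  have e' : u ⁻¹ᵁ V ≤ (u ≫ v) ⁻¹ᵁ W := by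
    rw [Scheme.Hom.comp_preimage]; exact u.preimage_mono e
  letI algAB : Algebra Γ(X, W) Γ(Z, V) := (v.appLE W V e).hom.toAlgebra
  letI algBC : Algebra Γ(Z, V) Γ(X₁, u ⁻¹ᵁ V) := (u.app V).hom.toAlgebra
  letI algAC : Algebra Γ(X, W) Γ(X₁, u ⁻¹ᵁ V) :=
    ((u.app V).hom.comp (v.appLE W V e).hom).toAlgebra
  haveI : IsScalarTower Γ(X, W) Γ(Z, V) Γ(X₁, u ⁻¹ᵁ V) :=
    IsScalarTower.of_algebraMap_eq fun _ ↦ rfl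
  haveI : IsNoetherianRing Γ(X, W) := IsLocallyNoetherian.component_noetherian ⟨W, hW⟩
  -- `C` is of finite type over `A`
  have hAC : Algebra.FiniteType Γ(X, W) Γ(X₁, u ⁻¹ᵁ V) := by
    have h := (u ≫ v).finiteType_appLE hW hV' e'
    have heq : (u ≫ v).appLE W (u ⁻¹ᵁ V) e' = v.appLE W V e ≫ u.app V := by
      rw [Scheme.Hom.app_eq_appLE, Scheme.Hom.appLE_comp_appLE]
    rw [heq] at h
    exact h
  -- `C` is integral and of finite type over `B`, hence finite
  haveI : Algebra.IsIntegral Γ(Z, V) Γ(X₁, u ⁻¹ᵁ V) :=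
    ⟨(IsIntegralHom.isIntegral_app u V hV)⟩
  haveI : Algebra.FiniteType Γ(Z, V) Γ(X₁, u ⁻¹ᵁ V) :=
    Algebra.FiniteType.of_restrictScalars_finiteType Γ(X, W) _ _
  haveI : Module.Finite Γ(Z, V) Γ(X₁, u ⁻¹ᵁ V) := Algebra.IsIntegral.finite
  have hfg : (⊤ : Subalgebra Γ(X, W) Γ(Z, V)).FG :=
    fg_of_fg_of_fg Γ(X, W) Γ(Z, V) Γ(X₁, u ⁻¹ᵁ V) hAC.out Module.Finite.fg_top (hu ⟨V, hV⟩)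
  exact ⟨hfg⟩

/-! ### Finiteness over a neighbourhood of a finite fibre -/

/-- **A fibre over a point of an open over which a morphism is finite is finite.** [folklore] -/
theorem finite_fiber_of_isFinite_morphismRestrict {X Y : Scheme.{u}} (f : X ⟶ Y) (U : Y.Opens)
    [IsFinite (f ∣_ U)] {y : Y} (hy : y ∈ U) : (f ⁻¹' {y}).Finite := by
  have h := (f ∣_ U).finite_preimage_singleton ⟨y, hy⟩
  have himg : f ⁻¹' {y} = (f ⁻¹ᵁ U).ι '' ((f ∣_ U) ⁻¹' {⟨y, hy⟩}) := by
    ext x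
    constructor
    · intro hx
      have hxU : x ∈ f ⁻¹ᵁ U := by
        change f x ∈ U
        rw [show f x = y from hx]; exact hy
      refine ⟨⟨x, hxU⟩, ?_, rfl⟩
      apply Subtype.ext
      change ((f ∣_ U) ⟨x, hxU⟩).1 = y
      rw [morphismRestrict_base_coe]
      exact hx
    · rintro ⟨x, hx, rfl⟩
      change f ((f ⁻¹ᵁ U).ι x) = y
      have := congrArg Subtype.val hx
      rw [morphismRestrict_base_coe] at this
      exact this
  rw [himg]
  exact h.image _

/-- **Finiteness over a neighbourhood descends along a surjection.** If `u ≫ v` is finite over an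
open neighbourhood `U₀` of `x`, `u` is surjective and `v` is proper, then `v` is finite over some
open neighbourhood of `x`: the fibre of `v` over `x` is the image of the finite fibre of `u ≫ v`,
and a proper morphism is finite near a finite fibre (Zariski's Main Theorem, Stacks 02UP).
[cite: StacksProject, Tag 02UP] -/
theorem exists_isFinite_morphismRestrict_of_comp {X₁ Z X : Scheme.{u}} (u : X₁ ⟶ Z) (v : Z ⟶ X)
    [IsProper v] (hu : Function.Surjective u) (U₀ : X.Opens) {x : X} (hx : x ∈ U₀)
    [IsFinite ((u ≫ v) ∣_ U₀)] : ∃ V : X.Opens, x ∈ V ∧ IsFinite (v ∣_ V) := by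
  have hfib : (v ⁻¹' {x}).Finite := by
    refine ((finite_fiber_of_isFinite_morphismRestrict (u ≫ v) U₀ hx).image u).subset ?_
    intro z hz
    obtain ⟨y, rfl⟩ := hu z
    exact ⟨y, by simpa [Scheme.Hom.comp_apply] using hz, rfl⟩
  exact exists_isFinite_morphismRestrict_of_finite_preimage_singleton v x hfib

end Literature.AlgebraicGeometry.RelativeSpec

end
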